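import Literature.Analysis.FluidPDE.FracTransportHolderEstimate
import Literature.Analysis.FluidPDE.OnsagerBDSVTransportHigher
import Literature.Analysis.FluidPDE.DeRosaTimeRegularityProofs
import HarnessLib

/-!
# Higher-order Hölder estimates for transport–diffusion equations with fractional dissipation
# (De Rosa 2019, §3.1, (3.5) and (3.7))

L. De Rosa, *Infinitely many Leray–Hopf solutions for the fractional Navier–Stokes equations*,
Comm. PDE 44 (2019) 335–365 = arXiv:1801.10235, §3.1, controls the `C^N` and `C^{N+α}` norms of
solutions of `uₜ + (v·∇)u + ν(-Δ)^γ u = f` (Prop. 3.2 (3.5), Prop. 3.3 (3.7)) by differentiating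
the equation — "differentiating (3.2) `N` times yields
`(D^N u)ₜ + L D^N u = D^N f + ∑_{k<N} c_{k,N} D^{k+1}u D^{N-k}v`" — and applying the `C⁰`/`C^α`
maximum-principle estimates (3.3)/(3.6) to the derivatives, then Grönwall; the same scheme, with
the commutator estimated by the Leibniz rule and absorbed under the CFL-type condition
`(t - t₀)‖v‖_{1+α} ≲ 1`, is the proof of the a priori bounds of Prop. 3.5 (§3.2) and of
Buckmaster–De Lellis–Székelyhidi–Vicol's Prop. 3.1/3.3 (in the tree:
`BDSV.eContDiffHolderNorm_transport_higher`, `OnsagerBDSVTransportHigher.lean`).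

This file proves the fractional twin of that level-`N` estimate, one partial derivative at a
time, for jointly smooth `ℝ^d`-valued fields on `[a,b] × T^d` (forward in time, data at `a`):

* `Torus.partialDeriv_fracLaplacian_comm` — `∂ₖ (-Δ)^θ a = (-Δ)^θ ∂ₖ a` for smooth `a`
  (both sides are smooth with Fourier coefficients `2πi kₖ (4π²|k|²)^θ â(k)`);
* `Torus.fracTransport_partialDeriv` — if `∂ₜF + (v·∇)F + ν(-Δ)^γ F = G` then
  `∂ₜ(∂ₖF) + (v·∇)(∂ₖF) + ν(-Δ)^γ(∂ₖF) = ∂ₖG - (∂ₖv·∇)F`;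
* `Torus.eContDiffHolderNorm_fracTransport_higher` — **the level-`N` estimate**: for every `N`
  there is `A = A(N,d) ≥ 1` (`A(0) = 6`, `A(N+1) = 8(d+1)3^N A(N)`) such that, if `‖Dv‖ ≤ K`
  with `K(b-a) ≤ 1/2`, `‖v(s)‖_{j,α} ≤ V_j` (`1 ≤ j ≤ N`) with `(b - a) V_1 A ≤ 1`,
  `‖F(s)‖_{m,α} ≤ Φ_m` for `1 ≤ m < N`, `‖F(a)‖_{N,α} ≤ F₀` and `‖G(s)‖_{N,α} ≤ G₀` on `[a,b]`,
  then `‖F(s)‖_{N,α} ≤ A (F₀ + (b-a) G₀ + (b-a) ∑_{j=1}^{N-1} V_{j+1} Φ_{N-j})` on `[a,b]`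
  (`0 ≤ α < 1`, `ν ≥ 0`, `0 < γ < 1`).

The induction is that of the BDSV file verbatim, with the base case and the `L^∞` step supplied
by the maximum-principle estimates `Torus.eContDiffHolderNorm_fracTransport_le`,
`Torus.eSupNorm_fracTransport_le` of `FracTransportHolderEstimate.lean`.

## References

* L. De Rosa, Comm. PDE 44 (2019) 335–365 = arXiv:1801.10235, §3.1: Prop. 3.2 (3.5) with its
  proof ("differentiating `N` times yields …"), Prop. 3.3 (3.7); §3.2, proof of Prop. 3.5.
  [`Derosa2018`]
* T. Buckmaster, C. De Lellis, L. Székelyhidi Jr., V. Vicol, CPAM 72 (2019) = arXiv:1701.08678,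
  §3.2 (proof of Prop. 3.3), App. B. [`BuckmasterEtAl2018`]
-/

noncomputable section

open MeasureTheory Set Filter Function UnitAddTorus
open scoped NNReal ENNReal ContDiff Topology

set_option maxSynthPendingDepth 3

namespace Literature.Analysis.FluidPDE

namespace Torus

open FunctionSpaces FunctionSpaces.Torus

variable {d : Type} [Fintype d] [DecidableEq d]

/-! ## `∂ₖ` commutes with `(-Δ)^θ` -/

/-- **Partial derivatives commute with the fractional Laplacian** on smooth fields (`θ ≥ 0`):
`∂ₖ (-Δ)^θ a = (-Δ)^θ (∂ₖ a)` — both sides are continuous with Fourier coefficients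
`2πi kₖ (4π²|k|²)^θ â(k)` (Grafakos 2014, Prop. 3.2.4). [folklore] -/
theorem partialDeriv_fracLaplacian_comm {θ : ℝ} (hθ : 0 ≤ θ)
    {a : UnitAddTorus d → EuclideanSpace ℝ d} (ha : IsSmooth a) (j : d) :
    FunctionSpaces.Torus.partialDeriv j (fracLaplacian θ a) = fracLaplacian θ (FunctionSpaces.Torus.partialDeriv j a) := by
  have hLa : IsSmooth (fracLaplacian θ a) := ha.fracLaplacian hθ
  have hL : IsSmooth (FunctionSpaces.Torus.partialDeriv j (fracLaplacian θ a)) := hLa.partialDeriv j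
  have hDa : IsSmooth (FunctionSpaces.Torus.partialDeriv j a) := ha.partialDeriv j
  have hR : IsSmooth (fracLaplacian θ (FunctionSpaces.Torus.partialDeriv j a)) := hDa.fracLaplacian hθ
  have hcoef : ∀ l, mFourierCoeff (EuclideanSpace.complexify ∘ FunctionSpaces.Torus.partialDeriv j (fracLaplacian θ a)) l =
      mFourierCoeff (EuclideanSpace.complexify ∘ fracLaplacian θ (FunctionSpaces.Torus.partialDeriv j a)) l := by
    intro l
    rw [mFourierCoeff_complexify_partialDeriv hLa, mFourierCoeff_complexify_fracLaplacian hθ ha,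
      mFourierCoeff_complexify_fracLaplacian hθ hDa, mFourierCoeff_complexify_partialDeriv ha, smul_comm]
  have hsub : (EuclideanSpace.complexify ∘ FunctionSpaces.Torus.partialDeriv j (fracLaplacian θ a)) -
      (EuclideanSpace.complexify ∘ fracLaplacian θ (FunctionSpaces.Torus.partialDeriv j a)) = 0 := by
    refine eq_zero_of_forall_mFourierCoeff_eq_zero
      ((EuclideanSpace.continuous_complexify.comp hL.continuous).sub
        (EuclideanSpace.continuous_complexify.comp hR.continuous)) fun l => ?_
    rw [mFourierCoeff_sub (integrable_complexify_comp hL.integrable)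
      (integrable_complexify_comp hR.integrable), hcoef l, sub_self]
  funext x
  apply EuclideanSpace.complexify_injective
  have hx := congr_fun hsub x
  simpa [sub_eq_zero] using hx

/-! ## Differentiating the transport–diffusion equation -/

/-- **Differentiating the transport–diffusion equation** (De Rosa 2019, proof of Prop. 3.2:
"differentiate (3.2) in the `x` variable to obtain `(Du)ₜ + L Du = Df - Dv Du`"): if
`∂ₜF + (v·∇)F + ν(-Δ)^γ F = G` on `[a,b] × T^d`, `a < b`, for jointly smooth `v, F` and
`γ ≥ 0`, then `∂ₜ(∂ₖF) + (v·∇)(∂ₖF) + ν(-Δ)^γ(∂ₖF) = ∂ₖG - (∂ₖv·∇)F`.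
[cite: Derosa2018, §3.1 proof of Prop. 3.2] -/
theorem fracTransport_partialDeriv {a b : ℝ} (hab : a < b) {ν γ : ℝ} (hγ : 0 ≤ γ)
    {v : ℝ → UnitAddTorus d → EuclideanSpace ℝ d}
    {Fl G : ℝ → UnitAddTorus d → EuclideanSpace ℝ d} (hv : FunctionSpaces.Torus.IsSmoothSpaceTimeOn (Icc a b) v)
    (hF : FunctionSpaces.Torus.IsSmoothSpaceTimeOn (Icc a b) Fl)
    (heq : ∀ s ∈ Icc a b, ∀ x, FunctionSpaces.Torus.timeDerivWithin (Icc a b) Fl s x + FunctionSpaces.Torus.convect (v s) (Fl s) x +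
      ν • fracLaplacian γ (Fl s) x = G s x)
    (k : d) {s : ℝ} (hs : s ∈ Icc a b) (x : UnitAddTorus d) :
    FunctionSpaces.Torus.timeDerivWithin (Icc a b) (fun t => FunctionSpaces.Torus.partialDeriv k (Fl t)) s x +
        FunctionSpaces.Torus.convect (v s) (FunctionSpaces.Torus.partialDeriv k (Fl s)) x + ν • fracLaplacian γ (FunctionSpaces.Torus.partialDeriv k (Fl s)) x =
      FunctionSpaces.Torus.partialDeriv k (G s) x - FunctionSpaces.Torus.convect (FunctionSpaces.Torus.partialDeriv k (v s)) (Fl s) x := by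
  have hvs : IsSmooth (v s) := hv.isSmooth_slice hs
  have hFs : IsSmooth (Fl s) := hF.isSmooth_slice hs
  have hTs : IsSmooth (FunctionSpaces.Torus.timeDerivWithin (Icc a b) Fl s) :=
    hF.isSmooth_timeDerivWithin (uniqueDiffOn_Icc hab) hs
  have hLs : IsSmooth (fracLaplacian γ (Fl s)) := hFs.fracLaplacian hγ
  have hGs : G s = FunctionSpaces.Torus.timeDerivWithin (Icc a b) Fl s +
      FunctionSpaces.Torus.convect (v s) (Fl s) + ν • fracLaplacian γ (Fl s) := by
    funext y
    exact (heq s hs y).symm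
  have h1 : IsContDiff 1 (FunctionSpaces.Torus.timeDerivWithin (Icc a b) Fl s) :=
    BDSV.isContDiff_one_of_isSmooth hTs
  have h2 : IsContDiff 1 (FunctionSpaces.Torus.convect (v s) (Fl s)) :=
    BDSV.isContDiff_one_of_isSmooth (hvs.convect hFs)
  have h3 : IsContDiff 1 (fracLaplacian γ (Fl s)) := BDSV.isContDiff_one_of_isSmooth hLs
  rw [timeDerivWithin_partialDeriv_comm hab hF hs k x, hGs,
    partialDeriv_add (h1.add h2) (h3.smul ν), partialDeriv_add h1 h2, Pi.add_apply, Pi.add_apply,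
    BDSV.partialDeriv_convect hvs hFs k x, partialDeriv_const_smul h3 ν k, Pi.smul_apply,
    partialDeriv_fracLaplacian_comm hγ hFs k]
  abel

/-! ## The level-`N` estimate -/

/-- **The level-`N` transport–diffusion estimate** (De Rosa 2019, §3.1, the higher-order
bounds (3.5), (3.7): "just differentiate the equation `N` times … and apply the previous argument",
with the commutator `∑ c_{k,N} D^{k+1}u D^{N-k}v` estimated by the Leibniz rule, exactly as in the
proof of Prop. 3.5, §3.2, and in BDSV §3.2; the fractional twin of
`BDSV.eContDiffHolderNorm_transport_higher`). For jointly smooth `v, F, G` on `[a,b] × T^d` with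
`∂ₜF + (v·∇)F + ν(-Δ)^γ F = G` (`ν ≥ 0`, `0 < γ < 1`), `‖Dv‖ ≤ K`, `K(b-a) ≤ 1/2`,
`‖v(s)‖_{j,α} ≤ V_j` (`1 ≤ j ≤ N`, `0 ≤ α < 1`), `(b-a) V_1 A ≤ 1` (`A = A(N,d)`, the constant
provided), `‖F(s)‖_{m,α} ≤ Φ_m` (`1 ≤ m < N`), `‖F(a)‖_{N,α} ≤ F₀` (data at the initial time:
the estimate is forward in time), `‖G(s)‖_{N,α} ≤ G₀`: for all `s ∈ [a,b]`,
`‖F(s)‖_{N,α} ≤ A (F₀ + (b-a) G₀ + (b-a) ∑_{i < N-1} V_{i+2} Φ_{N-1-i})`.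
[cite: Derosa2018, §3.1 Props. 3.2–3.3 (3.5), (3.7); §3.2 proof of Prop. 3.5] -/
theorem eContDiffHolderNorm_fracTransport_higher (N : ℕ) :
    ∃ A : ℝ, 1 ≤ A ∧ ∀ {a b : ℝ} (_ : a < b) {α : ℝ≥0} (_ : α < 1) {ν γ : ℝ} (_ : 0 ≤ ν)
      (_ : 0 < γ) (_ : γ < 1)
      {v : ℝ → UnitAddTorus d → EuclideanSpace ℝ d} (_ : FunctionSpaces.Torus.IsSmoothSpaceTimeOn (Icc a b) v)
      {K : ℝ≥0} (_ : ∀ s ∈ Icc a b, ∀ x, ‖Torus.fderiv (v s) x‖ ≤ K)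
      (_ : (K : ℝ) * (b - a) ≤ 1 / 2) {V : ℕ → ℝ} (_ : ∀ j, 0 ≤ V j),
      (∀ s ∈ Icc a b, ∀ j, 1 ≤ j → j ≤ N →
        Torus.eContDiffHolderNorm j α (v s) ≤ ENNReal.ofReal (V j)) →
      (b - a) * V 1 * A ≤ 1 →
      ∀ {Fl G : ℝ → UnitAddTorus d → EuclideanSpace ℝ d}, FunctionSpaces.Torus.IsSmoothSpaceTimeOn (Icc a b) Fl →
        FunctionSpaces.Torus.IsSmoothSpaceTimeOn (Icc a b) G →
        (∀ s ∈ Icc a b, ∀ x, FunctionSpaces.Torus.timeDerivWithin (Icc a b) Fl s x + FunctionSpaces.Torus.convect (v s) (Fl s) x +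
          ν • fracLaplacian γ (Fl s) x = G s x) →
        ∀ {Φ : ℕ → ℝ}, (∀ m, 0 ≤ Φ m) →
          (∀ s ∈ Icc a b, ∀ m, 1 ≤ m → m < N →
            Torus.eContDiffHolderNorm m α (Fl s) ≤ ENNReal.ofReal (Φ m)) →
          ∀ {F₀ G₀ : ℝ}, 0 ≤ F₀ → 0 ≤ G₀ →
            Torus.eContDiffHolderNorm N α (Fl a) ≤ ENNReal.ofReal F₀ →
            (∀ s ∈ Icc a b, Torus.eContDiffHolderNorm N α (G s) ≤ ENNReal.ofReal G₀) →
            ∀ s ∈ Icc a b, Torus.eContDiffHolderNorm N α (Fl s) ≤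
              ENNReal.ofReal (A *
                (F₀ + (b - a) * G₀ +
                  (b - a) * ∑ i ∈ Finset.range (N - 1), V (i + 2) * Φ (N - 1 - i))) := by
  induction N with
  | zero =>
    refine ⟨6, by norm_num, ?_⟩
    intro a b hab α hα ν γ hν hγ0 hγ1 v hv K hK hKL V hV0 _ _ Fl G hF _ heq Φ _ _ F₀ G₀ hF₀0 hG₀0 hF₀ hGb
      s hs
    have hL : 0 < b - a := sub_pos.2 hab
    set L := b - a with hLdef
    have ha : a ∈ Icc a b := left_mem_Icc.2 hab.le
    have h := Torus.eContDiffHolderNorm_fracTransport_le hab hv hF hν hγ0 hγ1 heq hK ha hs hs.1 hα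
      hF₀0 hG₀0 hF₀ (fun s' hs' => hGb s' ⟨hs'.1, hs'.2.trans hs.2⟩)
    refine h.trans (ENNReal.ofReal_le_ofReal ?_)
    have hst : s - a ≤ L := by linarith [hs.2]
    have hst0 : 0 ≤ s - a := sub_nonneg.2 hs.1
    have hexp : Real.exp (α * K * (s - a)) ≤ 3 := by
      have h1 : (α : ℝ) * K * (s - a) ≤ 1 := by
        have hαle : (α : ℝ) ≤ 1 := by exact_mod_cast hα.le
        have hα0 : (0 : ℝ) ≤ α := α.2
        have hK0 : (0 : ℝ) ≤ K := K.2
        have h2 : (K : ℝ) * (s - a) ≤ K * L := mul_le_mul_of_nonneg_left hst hK0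
        have h3 : (α : ℝ) * (K * (s - a)) ≤ 1 * (K * L) :=
          mul_le_mul hαle h2 (mul_nonneg hK0 hst0) zero_le_one
        calc (α : ℝ) * K * (s - a) = α * (K * (s - a)) := by ring
          _ ≤ 1 * (K * L) := h3
          _ ≤ 1 := by linarith
      calc Real.exp (α * K * (s - a)) ≤ Real.exp 1 := Real.exp_le_exp.2 h1
        _ ≤ 3 := Real.exp_one_lt_three.le
    simp only [Nat.zero_sub, Finset.range_zero, Finset.sum_empty, mul_zero, add_zero]
    have h2 : F₀ + 2 * (s - a) * G₀ ≤ 2 * (F₀ + L * G₀) := by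
      have h3 : (s - a) * G₀ ≤ L * G₀ := mul_le_mul_of_nonneg_right hst hG₀0
      linarith only [h3, hF₀0]
    calc Real.exp (α * K * (s - a)) * (F₀ + 2 * (s - a) * G₀) ≤ 3 * (2 * (F₀ + L * G₀)) :=
          mul_le_mul hexp h2 (by positivity) (by norm_num)
      _ = 6 * (F₀ + L * G₀) := by ring
  | succ N IH =>
    obtain ⟨A, hA1, hIH⟩ := IH
    have hA0 : 0 ≤ A := zero_le_one.trans hA1
    have hbig : ∀ D : ℕ, 1 ≤ 8 * ((D : ℝ) + 1) * 3 ^ N := fun D => by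
      have h3 : (1 : ℝ) ≤ 3 ^ N := one_le_pow₀ (by norm_num)
      have hD : (0 : ℝ) ≤ D := Nat.cast_nonneg D
      nlinarith
    refine ⟨8 * ((Fintype.card d : ℝ) + 1) * 3 ^ N * A, ?_, ?_⟩
    · calc (1 : ℝ) ≤ A := hA1
        _ ≤ 8 * ((Fintype.card d : ℝ) + 1) * 3 ^ N * A := le_mul_of_one_le_left hA0 (hbig _)
    intro a b hab α hα ν γ hν hγ0 hγ1 v hv K hK hKL V hV0 hV hsmall Fl G hF hG heq Φ hΦ0 hΦ F₀ G₀ hF₀0 hG₀0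
      hF₀ hGb
    have ha : a ∈ Icc a b := left_mem_Icc.2 hab.le
    have hL : 0 < b - a := sub_pos.2 hab
    set L := b - a with hLdef
    set D := Fintype.card d with hDdef
    have hU : UniqueDiffOn ℝ (Icc a b) := uniqueDiffOn_Icc hab
    set A' : ℝ := 8 * ((D : ℝ) + 1) * 3 ^ N * A with hA'def
    have hAA' : A ≤ A' := le_mul_of_one_le_left hA0 (hbig D)
    -- smallness at level `N`
    have hsmallN : L * V 1 * A ≤ 1 :=
      le_trans (mul_le_mul_of_nonneg_left hAA' (mul_nonneg hL.le (hV0 1))) hsmall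
    -- finiteness of the level-`N+1` norms and their supremum `M`
    obtain ⟨Bfin, hBfin0, hBfin⟩ := BDSV.exists_forall_eContDiffHolderNorm_le_of_Icc hab (N + 1) hα.le hF
    set S := ⨆ s ∈ Icc a b, Torus.eContDiffHolderNorm (N + 1) α (Fl s) with hSdef
    have hSle : S ≤ ENNReal.ofReal Bfin := iSup₂_le fun s hs => hBfin s hs
    have hST : S ≠ ⊤ := ne_top_of_le_ne_top ENNReal.ofReal_ne_top hSle
    set M := S.toReal with hMdef
    have hM0 : 0 ≤ M := ENNReal.toReal_nonneg
    have hFM : ∀ s ∈ Icc a b, Torus.eContDiffHolderNorm (N + 1) α (Fl s) ≤ ENNReal.ofReal M := by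
      intro s hs
      rw [hMdef, ENNReal.ofReal_toReal hST]
      exact le_iSup₂ (f := fun s _ => Torus.eContDiffHolderNorm (N + 1) α (Fl s)) s hs
    -- the lower-order sum at level `N+1`
    set Sig : ℝ := ∑ i ∈ Finset.range N, V (i + 2) * Φ (N - i) with hSigdef
    have hSig0 : 0 ≤ Sig := Finset.sum_nonneg fun i _ => mul_nonneg (hV0 _) (hΦ0 _)
    -- the forcing bound for the differentiated equations
    set G₁ : ℝ := G₀ + 3 ^ N * (V 1 * M + Sig) with hG₁def
    have hVM : 0 ≤ V 1 * M + Sig := add_nonneg (mul_nonneg (hV0 1) hM0) hSig0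
    have hG₁0 : 0 ≤ G₁ := add_nonneg hG₀0 (mul_nonneg (by positivity) hVM)
    -- the differentiated equation for each `k`
    have hstep : ∀ k, ∀ s ∈ Icc a b, Torus.eContDiffHolderNorm N α (FunctionSpaces.Torus.partialDeriv k (Fl s)) ≤
        ENNReal.ofReal (A * (F₀ + L * G₁ + L * Sig)) := by
      intro k
      set Fk : ℝ → UnitAddTorus d → EuclideanSpace ℝ d := fun t => FunctionSpaces.Torus.partialDeriv k (Fl t) with hFkdef
      set Gk : ℝ → UnitAddTorus d → EuclideanSpace ℝ d := fun t x =>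
        FunctionSpaces.Torus.partialDeriv k (G t) x - FunctionSpaces.Torus.convect (FunctionSpaces.Torus.partialDeriv k (v t)) (Fl t) x with hGkdef
      have hFk : FunctionSpaces.Torus.IsSmoothSpaceTimeOn (Icc a b) Fk := hF.partialDeriv hU k
      have hGk : FunctionSpaces.Torus.IsSmoothSpaceTimeOn (Icc a b) Gk :=
        (hG.partialDeriv hU k).sub ((hv.partialDeriv hU k).convect hF hU)
      have heqk : ∀ s ∈ Icc a b, ∀ x,
          FunctionSpaces.Torus.timeDerivWithin (Icc a b) Fk s x + FunctionSpaces.Torus.convect (v s) (Fk s) x + ν • fracLaplacian γ (Fk s) x =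
            Gk s x :=
        fun s hs x => fracTransport_partialDeriv hab hγ0.le hv hF heq k hs x
      -- hypotheses of the induction hypothesis
      have hVN : ∀ s ∈ Icc a b, ∀ j, 1 ≤ j → j ≤ N →
          Torus.eContDiffHolderNorm j α (v s) ≤ ENNReal.ofReal (V j) :=
        fun s hs j hj hjN => hV s hs j hj (hjN.trans (Nat.le_succ N))
      have hΦk : ∀ s ∈ Icc a b, ∀ m, 1 ≤ m → m < N →
          Torus.eContDiffHolderNorm m α (Fk s) ≤ ENNReal.ofReal (Φ (m + 1)) := by
        intro s hs m hm hmN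
        have hFs : IsSmooth (Fl s) := hF.isSmooth_slice hs
        exact (Torus.eContDiffHolderNorm_partialDeriv_le
          (hFs.isContDiff (by exact_mod_cast le_top)) k α).trans
          (hΦ s hs (m + 1) (Nat.le_add_left 1 m) (Nat.succ_lt_succ hmN))
      have hF₀k : Torus.eContDiffHolderNorm N α (Fk a) ≤ ENNReal.ofReal F₀ :=
        (Torus.eContDiffHolderNorm_partialDeriv_le
          ((hF.isSmooth_slice ha).isContDiff (by exact_mod_cast le_top)) k α).trans hF₀
      have hGk' : ∀ s ∈ Icc a b, Torus.eContDiffHolderNorm N α (Gk s) ≤ ENNReal.ofReal G₁ := by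
        intro s hs
        have hvs : IsSmooth (v s) := hv.isSmooth_slice hs
        have hFs : IsSmooth (Fl s) := hF.isSmooth_slice hs
        have hGs : IsSmooth (G s) := hG.isSmooth_slice hs
        have h1 : Torus.eContDiffHolderNorm N α (FunctionSpaces.Torus.partialDeriv k (G s)) ≤ ENNReal.ofReal G₀ :=
          (Torus.eContDiffHolderNorm_partialDeriv_le
            (hGs.isContDiff (by exact_mod_cast le_top)) k α).trans (hGb s hs)
        -- the commutator term
        have h2 : Torus.eContDiffHolderNorm N α (FunctionSpaces.Torus.convect (FunctionSpaces.Torus.partialDeriv k (v s)) (Fl s)) ≤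
            ENNReal.ofReal (3 ^ N * (V 1 * M + Sig)) := by
          have hc := Torus.eContDiffHolderNorm_convect_le (u := FunctionSpaces.Torus.partialDeriv k (v s)) (v := Fl s)
            ((hvs.partialDeriv k).isContDiff (by exact_mod_cast le_top))
            (hFs.isContDiff (by exact_mod_cast le_top)) α (k := N)
          refine hc.trans ?_
          -- bound each term of the Leibniz sum
          have hu : ∀ j, j ≤ N → Torus.eContDiffHolderNorm j α (FunctionSpaces.Torus.partialDeriv k (v s)) ≤
              ENNReal.ofReal (V (j + 1)) := fun j hj =>
            (Torus.eContDiffHolderNorm_partialDeriv_le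
              (hvs.isContDiff (by exact_mod_cast le_top)) k α).trans
              (hV s hs (j + 1) (Nat.le_add_left 1 j) (Nat.succ_le_succ hj))
          have hterm0 : Torus.eContDiffHolderNorm 0 α (FunctionSpaces.Torus.partialDeriv k (v s)) *
              Torus.eContDiffHolderNorm (N - 0 + 1) α (Fl s) ≤
              ENNReal.ofReal (V 1) * ENNReal.ofReal M :=
            mul_le_mul' (hu 0 (Nat.zero_le N)) (by rw [Nat.sub_zero]; exact hFM s hs)
          have htermi : ∀ i ∈ Finset.range N,
              Torus.eContDiffHolderNorm (i + 1) α (FunctionSpaces.Torus.partialDeriv k (v s)) *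
                Torus.eContDiffHolderNorm (N - (i + 1) + 1) α (Fl s) ≤
              ENNReal.ofReal (V (i + 2)) * ENNReal.ofReal (Φ (N - i)) := by
            intro i hi
            have hiN : i < N := Finset.mem_range.1 hi
            have heq' : N - (i + 1) + 1 = N - i := by omega
            refine mul_le_mul' (hu (i + 1) hiN) ?_
            rw [heq']
            exact hΦ s hs (N - i) (by omega) (by omega)
          calc 3 ^ N * ∑ j ∈ Finset.range (N + 1), Torus.eContDiffHolderNorm j α (FunctionSpaces.Torus.partialDeriv k (v s)) *
                  Torus.eContDiffHolderNorm (N - j + 1) α (Fl s)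
              = 3 ^ N * ((∑ i ∈ Finset.range N,
                  Torus.eContDiffHolderNorm (i + 1) α (FunctionSpaces.Torus.partialDeriv k (v s)) *
                    Torus.eContDiffHolderNorm (N - (i + 1) + 1) α (Fl s)) +
                  Torus.eContDiffHolderNorm 0 α (FunctionSpaces.Torus.partialDeriv k (v s)) *
                    Torus.eContDiffHolderNorm (N - 0 + 1) α (Fl s)) := by
                rw [Finset.sum_range_succ']
            _ ≤ 3 ^ N * ((∑ i ∈ Finset.range N, ENNReal.ofReal (V (i + 2)) * ENNReal.ofReal (Φ (N - i))) +
                  ENNReal.ofReal (V 1) * ENNReal.ofReal M) :=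
                mul_le_mul' le_rfl (add_le_add (Finset.sum_le_sum htermi) hterm0)
            _ = ENNReal.ofReal (3 ^ N * (V 1 * M + Sig)) := by
                rw [hSigdef, ENNReal.ofReal_mul (by positivity), ENNReal.ofReal_pow (by norm_num),
                  ENNReal.ofReal_ofNat, ENNReal.ofReal_add (mul_nonneg (hV0 1) hM0) hSig0,
                  ENNReal.ofReal_mul (hV0 1), ENNReal.ofReal_sum_of_nonneg
                    (fun i _ => mul_nonneg (hV0 _) (hΦ0 _)), add_comm]
                congr 2
                exact Finset.sum_congr rfl fun i _ => (ENNReal.ofReal_mul (hV0 _)).symm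
        have hsub : IsContDiff N (FunctionSpaces.Torus.partialDeriv k (G s)) :=
          (hGs.partialDeriv k).isContDiff (by exact_mod_cast le_top)
        have hconv : IsContDiff N (FunctionSpaces.Torus.convect (FunctionSpaces.Torus.partialDeriv k (v s)) (Fl s)) :=
          ((hvs.partialDeriv k).convect hFs).isContDiff (by exact_mod_cast le_top)
        have hGk_eq : Gk s = FunctionSpaces.Torus.partialDeriv k (G s) - FunctionSpaces.Torus.convect (FunctionSpaces.Torus.partialDeriv k (v s)) (Fl s) := rfl
        rw [hGk_eq]
        refine (Torus.eContDiffHolderNorm_sub_le hsub hconv).trans ?_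
        rw [hG₁def, ENNReal.ofReal_add hG₀0 (mul_nonneg (by positivity) hVM)]
        exact add_le_add h1 h2
      -- apply the induction hypothesis
      have hIH' := hIH hab hα hν hγ0 hγ1 hv hK hKL hV0 hVN hsmallN hFk hGk heqk (Φ := fun m => Φ (m + 1))
        (fun m => hΦ0 _) hΦk hF₀0 hG₁0 hF₀k hGk'
      intro s hs
      refine (hIH' s hs).trans (ENNReal.ofReal_le_ofReal ?_)
      refine mul_le_mul_of_nonneg_left (add_le_add le_rfl (mul_le_mul_of_nonneg_left ?_ hL.le)) hA0
      -- the lower-order sum at level `N` is part of the one at level `N+1`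
      rw [hSigdef]
      have hsub : Finset.range (N - 1) ⊆ Finset.range N := Finset.range_mono (Nat.sub_le N 1)
      refine le_trans (le_of_eq ?_) (Finset.sum_le_sum_of_subset_of_nonneg hsub
        fun i _ _ => mul_nonneg (hV0 _) (hΦ0 _))
      refine Finset.sum_congr rfl fun i hi => ?_
      have hi' : i < N - 1 := Finset.mem_range.1 hi
      congr 2
      omega
    -- assemble: the level-`N+1` norm through the sup norm and the partial derivatives
    have hsupF : ∀ s ∈ Icc a b, eSupNorm (Fl s) ≤ ENNReal.ofReal (F₀ + L * G₀) := by
      intro s hs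
      have h := Torus.eSupNorm_fracTransport_le hF hν hγ0 hγ1 heq ha hs hs.1
      refine h.trans ?_
      have h1 : eSupNorm (Fl a) ≤ ENNReal.ofReal F₀ :=
        (Torus.eSupNorm_le_eContDiffHolderNorm (N + 1) α _).trans hF₀
      have h2 : (⨆ s' ∈ Icc a s, eSupNorm (G s')) ≤ ENNReal.ofReal G₀ :=
        iSup₂_le fun s' hs' => (Torus.eSupNorm_le_eContDiffHolderNorm (N + 1) α _).trans
          (hGb s' ⟨hs'.1, hs'.2.trans hs.2⟩)
      have hst : s - a ≤ L := by linarith [hs.2]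
      calc eSupNorm (Fl a) + ENNReal.ofReal (s - a) * ⨆ s' ∈ Icc a s, eSupNorm (G s')
          ≤ ENNReal.ofReal F₀ + ENNReal.ofReal L * ENNReal.ofReal G₀ :=
            add_le_add h1 (mul_le_mul' (ENNReal.ofReal_le_ofReal hst) h2)
        _ = ENNReal.ofReal (F₀ + L * G₀) := by
            rw [← ENNReal.ofReal_mul hL.le, ENNReal.ofReal_add hF₀0 (by positivity)]
    set X : ℝ := F₀ + L * G₀ + D * (A * (F₀ + L * G₁ + L * Sig)) with hXdef
    have hD0 : (0 : ℝ) ≤ D := Nat.cast_nonneg D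
    have hX1 : 0 ≤ F₀ + L * G₀ := add_nonneg hF₀0 (mul_nonneg hL.le hG₀0)
    have hin : 0 ≤ F₀ + L * G₁ + L * Sig :=
      add_nonneg (add_nonneg hF₀0 (mul_nonneg hL.le hG₁0)) (mul_nonneg hL.le hSig0)
    have hX2 : 0 ≤ (D : ℝ) * (A * (F₀ + L * G₁ + L * Sig)) := mul_nonneg hD0 (mul_nonneg hA0 hin)
    have hX0 : 0 ≤ X := add_nonneg hX1 hX2
    have hFX : ∀ s ∈ Icc a b, Torus.eContDiffHolderNorm (N + 1) α (Fl s) ≤ ENNReal.ofReal X := by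
      intro s hs
      have hFs : IsSmooth (Fl s) := hF.isSmooth_slice hs
      calc Torus.eContDiffHolderNorm (N + 1) α (Fl s)
          ≤ eSupNorm (Fl s) + ∑ k, Torus.eContDiffHolderNorm N α (FunctionSpaces.Torus.partialDeriv k (Fl s)) :=
            BDSV.eContDiffHolderNorm_succ_le_sum hFs N α
        _ ≤ ENNReal.ofReal (F₀ + L * G₀) +
              ∑ _k : d, ENNReal.ofReal (A * (F₀ + L * G₁ + L * Sig)) :=
            add_le_add (hsupF s hs) (Finset.sum_le_sum fun k _ => hstep k s hs)
        _ = ENNReal.ofReal X := by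
            rw [Finset.sum_const, Finset.card_univ, ← hDdef, nsmul_eq_mul, ← ENNReal.ofReal_natCast D,
              ← ENNReal.ofReal_mul (Nat.cast_nonneg D), hXdef]
            exact (ENNReal.ofReal_add hX1 hX2).symm
    -- absorb: `M ≤ X = X' + θ M` with `θ ≤ 1/8`
    have hMX : M ≤ X := by
      have h : S ≤ ENNReal.ofReal X := iSup₂_le fun s hs => hFX s hs
      have h' : ENNReal.ofReal M = S := by rw [hMdef, ENNReal.ofReal_toReal hST]
      rw [← h'] at h
      exact (ENNReal.ofReal_le_ofReal_iff hX0).1 h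
    set X' : ℝ := F₀ + L * G₀ + D * (A * (F₀ + L * (G₀ + 3 ^ N * Sig) + L * Sig)) with hX'def
    have hθ : D * A * L * 3 ^ N * V 1 ≤ 1 / 8 := by
      have h1 : (D : ℝ) * A * 3 ^ N ≤ A' / 8 := by
        rw [hA'def]
        have h3 : (0 : ℝ) ≤ 3 ^ N * A := by positivity
        have h4 : 8 * ((D : ℝ) + 1) * 3 ^ N * A / 8 = D * A * 3 ^ N + 3 ^ N * A := by ring
        rw [h4]
        linarith only [h3]
      calc (D : ℝ) * A * L * 3 ^ N * V 1 = (D * A * 3 ^ N) * (L * V 1) := by ring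
        _ ≤ A' / 8 * (L * V 1) :=
            mul_le_mul_of_nonneg_right h1 (mul_nonneg hL.le (hV0 1))
        _ = (L * V 1 * A') / 8 := by ring
        _ ≤ 1 / 8 := by linarith
    have hXsplit : X = X' + (D * A * L * 3 ^ N * V 1) * M := by
      rw [hXdef, hX'def, hG₁def]
      ring
    have hM2 : M ≤ 2 * X' := by
      have h1 : M ≤ X' + (1 / 8) * M := by
        calc M ≤ X := hMX
          _ = X' + (D * A * L * 3 ^ N * V 1) * M := hXsplit
          _ ≤ X' + (1 / 8) * M := by
              refine add_le_add le_rfl (mul_le_mul_of_nonneg_right hθ hM0)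
      have hX'0 : 0 ≤ X' := by positivity
      linarith
    -- conclude
    intro s hs
    refine (hFM s hs).trans (ENNReal.ofReal_le_ofReal (hM2.trans ?_))
    rw [show N + 1 - 1 = N from rfl, hA'def]
    -- `2 X' ≤ A_{N+1} (F₀ + L G₀ + L Sig)`
    have h3N : (1 : ℝ) ≤ 3 ^ N := one_le_pow₀ (by norm_num)
    have hDA : 0 ≤ (D : ℝ) * A := mul_nonneg hD0 hA0
    have hP1 : 0 ≤ (3 ^ N - 1) * (((D : ℝ) + 1) * A) :=
      mul_nonneg (sub_nonneg.2 h3N) (mul_nonneg (by linarith) hA0)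
    have hcoef1 : 2 * (1 + D * A) ≤ 8 * (D + 1) * 3 ^ N * A := by linarith only [hP1, hDA, hA1]
    have hcoef2 : 2 * (D * A * (3 ^ N + 1)) ≤ 8 * (D + 1) * 3 ^ N * A := by
      have hP2 : 0 ≤ (3 ^ N - 1) * ((D : ℝ) * A) := mul_nonneg (sub_nonneg.2 h3N) hDA
      have hP3 : 0 ≤ (3 : ℝ) ^ N * A := mul_nonneg (zero_le_one.trans h3N) hA0
      linarith only [hP2, hP3, hDA]
    have hX'eq : 2 * X' = 2 * (1 + D * A) * F₀ + 2 * (1 + D * A) * (L * G₀) +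
        2 * (D * A * (3 ^ N + 1)) * (L * Sig) := by
      rw [hX'def]
      ring
    rw [hX'eq]
    have hLG : 0 ≤ L * G₀ := by positivity
    have hLS : 0 ≤ L * Sig := by positivity
    calc 2 * (1 + D * A) * F₀ + 2 * (1 + D * A) * (L * G₀) + 2 * (D * A * (3 ^ N + 1)) * (L * Sig)
        ≤ 8 * (D + 1) * 3 ^ N * A * F₀ + 8 * (D + 1) * 3 ^ N * A * (L * G₀) +
            8 * (D + 1) * 3 ^ N * A * (L * Sig) := by
          refine add_le_add (add_le_add ?_ ?_) ?_
          · exact mul_le_mul_of_nonneg_right hcoef1 hF₀0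
          · exact mul_le_mul_of_nonneg_right hcoef1 hLG
          · exact mul_le_mul_of_nonneg_right hcoef2 hLS
      _ = 8 * (D + 1) * 3 ^ N * A * (F₀ + L * G₀ + L * Sig) := by ring

end Torus

end Literature.Analysis.FluidPDE
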